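import Summits.QuantumAdvantage.AdviceFreeQNC0.PairLocalFibre
import Summits.QuantumAdvantage.AdviceFreeQNC0.WalkGapNaming
import HarnessLib

/-!
# Few far readers of a pair: the three-speed parity identity in a reader-free block (bookkeeping for rung R8)

Planner qa-qnc0-p2 g15's rung R8 `WalkHardFFewReaders` (ROUND-15 (p2) §3.6): a polylog-degree strategy for α's u-walk game
in which some adjacent pair `(u_a, u_{a+1})` is read by the near cuts and by at most `(log₂ n)^C` FAR cuts (the readers `S`)
loses a constant fraction.  This file is the fibre layer of the proof, built on qn-prover-3 g8's overwrite chart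
`GapFibre.ow i L x z` (bit block `E = [i, i+L)`) and the pair chart `setPair a t` (pair weight `t ∈ {0,1,2}`):

* `FewReaders.setPair`, its weights (`wt_setPair`, `wtPrefix_setPair_of_le/ge`), commutation with `ow` (`ow_setPair`);
* the SPECIAL cuts `T` (near cuts and readers) are assumed NOT strictly inside `E`; every other cut does not read the pair;
* **three-speed parity identity** (`FewReaders.sum_winCount_mod_two`): for a background `x` and block bits `z`,
  `Σ_{t<3} winCount(u_t) ≡ Q_ω(x,z) (mod 2)` with `ω = |z| mod 3`, where `u_t = ow i L (setPair a t x) z` and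
  `Q_ω(x,z) = Σ_t #{g ∈ T : y_g(u_t) = 1 ∧ κ_g(setPair a t x) + speed_g·ω ≢ 0 (mod 3)}` (g8's `GapFibre.exponent_ow`: a cut not
  strictly inside `E` has exponent `κ_g + speed_g·|z|`); a non-special cut fires on all three speeds or none and its exponent is
  shifted by `t` or `2t`, so it is charged on exactly two speeds.  `Σ_ω Q_ω` is even (`sum_Q_mod_two`), so a losing residue
  `ω♭(x,z)` exists; it is a function of the `3|T|` firing bits `y_g(u_t)`, `g ∈ T` (`Q_congr`), each of `𝔽_p`-degree `≤ D` in `z`,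
  so its level sets have degree `≤ 3|T|·D` (`levelSet_mem_lowDeg`); and `ω♭(x,z) = |z| mod 3` forces a LOSING representative
  (`exists_loss_of_omegaBad_eq`).
WHAT THIS IS NOT: no count over backgrounds and no asymptotics (those are in `WalkHardFFewReaders.lean`); separation NOT moved.
-/

namespace Summit.QuantumAdvantage.AdviceFreeQNC0

open Finset Literature.Computability.MetaComplexity Literature.Computability.MetaComplexity.Hegedus
open Literature.Computability.MetaComplexity.Smolensky

namespace FewReaders

variable {n : ℕ}

/-! ### The pair chart on a background -/

/-- Set the pair `(u_a, u_{a+1})` of `x` to `([1 ≤ t], [2 ≤ t])` (pair weight `t` for `t ≤ 2`). -/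
def setPair (a t : ℕ) (x : Fin n → Bool) : Fin n → Bool := fun j =>
  if j.val = a then decide (1 ≤ t) else if j.val = a + 1 then decide (2 ≤ t) else x j

/-- Off the pair, `setPair` reads the background. -/
theorem setPair_of_ne (a t : ℕ) (x : Fin n → Bool) (j : Fin n) (h₁ : j.val ≠ a) (h₂ : j.val ≠ a + 1) :
    setPair a t x j = x j := by
  unfold setPair; rw [if_neg h₁, if_neg h₂]

/-- First pair bit. -/
theorem setPair_fst (a t : ℕ) (x : Fin n → Bool) (j : Fin n) (h : j.val = a) : setPair a t x j = decide (1 ≤ t) := by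
  unfold setPair; rw [if_pos h]

/-- Second pair bit. -/
theorem setPair_snd (a t : ℕ) (x : Fin n → Bool) (j : Fin n) (h : j.val = a + 1) :
    setPair a t x j = decide (2 ≤ t) := by
  unfold setPair; rw [if_neg (by omega), if_pos h]

/-- The representatives agree off the pair. -/
theorem setPair_agree (a t t' : ℕ) (x : Fin n → Bool) (j : Fin n) (h₁ : j.val ≠ a) (h₂ : j.val ≠ a + 1) :
    setPair a t x j = setPair a t' x j := by
  rw [setPair_of_ne a t x j h₁ h₂, setPair_of_ne a t' x j h₁ h₂]

/-- `|setPair a t x| = |setPair a 0 x| + t` for `t ≤ 2` (the pair inside the cube). -/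
theorem wt_setPair {a : ℕ} (ha : a + 1 < n) {t : ℕ} (ht : t < 3) (x : Fin n → Bool) :
    wt (setPair a t x) = wt (setPair a 0 x) + t := by
  unfold wt
  rw [Finset.card_filter, Finset.card_filter]
  have key := PairLocal.sum_eq_of_agree_off_two (fun j => if setPair a t x j = true then 1 else 0)
    (fun j => if setPair a 0 x j = true then 1 else 0) ⟨a, by omega⟩ ⟨a + 1, ha⟩
    (by simp) (fun j h₁ h₂ => by
      rw [setPair_agree a t 0 x j (fun h => h₁ (Fin.ext h)) (fun h => h₂ (Fin.ext h))])
  simp only [setPair_fst a _ x ⟨a, _⟩ rfl, setPair_snd a _ x ⟨a + 1, _⟩ rfl] at key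
  have h0 : ¬ (1 ≤ 0) := by omega
  have h0' : ¬ (2 ≤ 0) := by omega
  simp only [h0, h0', decide_false] at key
  rcases (show t = 0 ∨ t = 1 ∨ t = 2 by omega) with rfl | rfl | rfl
  · simp
  · simpa using key
  · simpa using key

/-- Prefix weights before the pair: `W_g(setPair a t x) = W_g(setPair a 0 x)` for `g ≤ a`. -/
theorem wtPrefix_setPair_of_le (a t : ℕ) (x : Fin n → Bool) {g : ℕ} (hg : g ≤ a) :
    wtPrefix (setPair a t x) g = wtPrefix (setPair a 0 x) g := by
  unfold wtPrefix
  congr 1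
  ext j
  simp only [mem_filter, mem_univ, true_and]
  constructor
  · rintro ⟨hj, hu⟩
    exact ⟨hj, by rwa [setPair_agree a 0 t x j (by omega) (by omega)]⟩
  · rintro ⟨hj, hu⟩
    exact ⟨hj, by rwa [setPair_agree a t 0 x j (by omega) (by omega)]⟩

/-- Prefix weights after the pair: `W_g(setPair a t x) = W_g(setPair a 0 x) + t` for `g ≥ a + 2`, `t ≤ 2`. -/
theorem wtPrefix_setPair_of_ge {a : ℕ} (ha : a + 1 < n) {t : ℕ} (ht : t < 3) (x : Fin n → Bool) {g : ℕ}
    (hg : a + 2 ≤ g) : wtPrefix (setPair a t x) g = wtPrefix (setPair a 0 x) g + t := by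
  unfold wtPrefix
  rw [Finset.card_filter, Finset.card_filter]
  have key := PairLocal.sum_eq_of_agree_off_two (fun j => if j.val < g ∧ setPair a t x j = true then 1 else 0)
    (fun j => if j.val < g ∧ setPair a 0 x j = true then 1 else 0) ⟨a, by omega⟩ ⟨a + 1, ha⟩
    (by simp) (fun j h₁ h₂ => by
      rw [setPair_agree a t 0 x j (fun h => h₁ (Fin.ext h)) (fun h => h₂ (Fin.ext h))])
  simp only [setPair_fst a _ x ⟨a, _⟩ rfl, setPair_snd a _ x ⟨a + 1, _⟩ rfl] at key
  have h0 : ¬ (1 ≤ 0) := by omega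
  have h0' : ¬ (2 ≤ 0) := by omega
  have hga : a < g := by omega
  have hga' : a + 1 < g := by omega
  simp only [h0, h0', decide_false, hga, hga', true_and] at key
  rcases (show t = 0 ∨ t = 1 ∨ t = 2 by omega) with rfl | rfl | rfl
  · simp
  · simpa using key
  · simpa using key

/-- The block overwrite and the pair chart commute when the block `E = [i, i+L)` avoids the pair. -/
theorem ow_setPair {i L a : ℕ} (hE : i + L ≤ a ∨ a + 2 ≤ i) (t : ℕ) (x : Fin n → Bool) (z : Fin L → Bool) :
    GapFibre.ow i L (setPair a t x) z = setPair a t (GapFibre.ow i L x z) := by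
  funext b
  by_cases hb : i ≤ b.val ∧ b.val < i + L
  · rw [GapFibre.ow_of_inE _ z hb, setPair_of_ne a t _ b (by omega) (by omega), GapFibre.ow_of_inE _ z hb]
  · rw [GapFibre.ow_of_not_inE _ z hb]
    by_cases h₁ : b.val = a
    · rw [setPair_fst a t _ b h₁, setPair_fst a t _ b h₁]
    · by_cases h₂ : b.val = a + 1
      · rw [setPair_snd a t _ b h₂, setPair_snd a t _ b h₂]
      · rw [setPair_of_ne a t _ b h₁ h₂, setPair_of_ne a t _ b h₁ h₂, GapFibre.ow_of_not_inE _ z hb]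

/-! ### The counts -/

/-- The fired-and-charged count whose parity is `ringWinU c y u`. -/
def winCount (c : ℕ) (y : Fin (n + 1) → (Fin n → Bool) → Bool) (u : Fin n → Bool) : ℕ :=
  (univ.filter fun g : Fin (n + 1) => y g u = true ∧ (c + g.val + walkExp u g.val) % 3 ≠ 0).card

/-- `ringWinU` is the parity of `winCount`. -/
theorem ringWinU_eq_decide (c : ℕ) (y : Fin (n + 1) → (Fin n → Bool) → Bool) (u : Fin n → Bool) :
    ringWinU c y u = decide (winCount c y u % 2 = 1) := rfl

/-- The special count against residue `ω`: `Q_ω(x,z) = Σ_{t<3} #{g ∈ T : y_g(u_t) = 1 ∧ κ_g(setPair a t x) + speed_g·ω ≢ 0}`,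
`u_t = ow i L (setPair a t x) z`.  It reads `z` only through the firing bits of the special cuts. -/
def Q (y : Fin (n + 1) → (Fin n → Bool) → Bool) (T : Finset (Fin (n + 1))) (i L a c : ℕ) (x : Fin n → Bool)
    (z : Fin L → Bool) (ω : ℕ) : ℕ :=
  ∑ t ∈ range 3, (T.filter fun g => y g (GapFibre.ow i L (setPair a t x) z) = true ∧
    (GapFibre.kappa i L c (setPair a t x) g.val + GapFibre.speed i g.val * ω) % 3 ≠ 0).card

/-- **The three-speed parity identity (reader form).**  `T` = the special cuts (not strictly inside the block `E`, which
avoids the pair); every other cut does not read the pair and is weakly left of `a` or weakly right of `a + 2`.  Then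
`Σ_{t<3} winCount(u_t) ≡ Q_{|z| mod 3}(x,z) (mod 2)`. -/
theorem sum_winCount_mod_two {i L a : ℕ} (hiL : i + L ≤ n) (hE : i + L ≤ a ∨ a + 2 ≤ i) (ha : a + 1 < n) (c : ℕ)
    (y : Fin (n + 1) → (Fin n → Bool) → Bool) (T : Finset (Fin (n + 1)))
    (hT : ∀ g ∈ T, g.val ≤ i ∨ i + L ≤ g.val)
    (hns : ∀ g : Fin (n + 1), g ∉ T → (g.val ≤ a ∨ a + 2 ≤ g.val) ∧ ∀ u u' : Fin n → Bool,
      (∀ j : Fin n, j.val ≠ a → j.val ≠ a + 1 → u j = u' j) → y g u = y g u')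
    (x : Fin n → Bool) (z : Fin L → Bool) :
    (∑ t ∈ range 3, winCount c y (GapFibre.ow i L (setPair a t x) z)) % 2 = Q y T i L a c x z (wt z % 3) % 2 := by
  classical
  -- split each count into special and non-special cuts
  have hsplit : ∀ t, winCount c y (GapFibre.ow i L (setPair a t x) z) =
      (∑ g ∈ univ.filter (fun g : Fin (n + 1) => g ∈ T), if (y g (GapFibre.ow i L (setPair a t x) z) = true ∧
        (c + g.val + walkExp (GapFibre.ow i L (setPair a t x) z) g.val) % 3 ≠ 0) then 1 else 0) +
      ∑ g ∈ univ.filter (fun g : Fin (n + 1) => ¬ g ∈ T), (if (y g (GapFibre.ow i L (setPair a t x) z) = true ∧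
        (c + g.val + walkExp (GapFibre.ow i L (setPair a t x) z) g.val) % 3 ≠ 0) then 1 else 0) := by
    intro t
    unfold winCount
    rw [Finset.card_filter, Finset.sum_filter_add_sum_filter_not]
  -- special part = the summand of `Q_{|z| mod 3}`
  have hspec : ∀ t ∈ range 3,
      (∑ g ∈ univ.filter (fun g : Fin (n + 1) => g ∈ T), if (y g (GapFibre.ow i L (setPair a t x) z) = true ∧
        (c + g.val + walkExp (GapFibre.ow i L (setPair a t x) z) g.val) % 3 ≠ 0) then 1 else 0) =
      (T.filter fun g => y g (GapFibre.ow i L (setPair a t x) z) = true ∧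
        (GapFibre.kappa i L c (setPair a t x) g.val + GapFibre.speed i g.val * (wt z % 3)) % 3 ≠ 0).card := by
    intro t _
    rw [Finset.card_filter, Finset.filter_univ_mem]
    refine Finset.sum_congr rfl fun g hg => ?_
    have hexp := GapFibre.exponent_ow hiL c (setPair a t x) z (hT g hg)
    have hmod : (c + g.val + walkExp (GapFibre.ow i L (setPair a t x) z) g.val) % 3 =
        (GapFibre.kappa i L c (setPair a t x) g.val + GapFibre.speed i g.val * (wt z % 3)) % 3 := by
      rw [hexp]; unfold GapFibre.speed; split_ifs <;> omega
    rw [hmod]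
  -- non-special part: each fired cut is charged on exactly two speeds
  have hfar : (∑ t ∈ range 3, ∑ g ∈ univ.filter (fun g : Fin (n + 1) => ¬ g ∈ T),
      (if (y g (GapFibre.ow i L (setPair a t x) z) = true ∧
        (c + g.val + walkExp (GapFibre.ow i L (setPair a t x) z) g.val) % 3 ≠ 0) then 1 else 0)) % 2 = 0 := by
    rw [Finset.sum_comm]
    refine Nat.mod_eq_zero_of_dvd (Finset.dvd_sum fun g hg => ?_)
    have hgT : g ∉ T := (mem_filter.1 hg).2
    obtain ⟨hga, hread⟩ := hns g hgT
    have hfire : ∀ t, y g (GapFibre.ow i L (setPair a t x) z) = y g (GapFibre.ow i L (setPair a 0 x) z) := fun t => by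
      rw [ow_setPair hE, ow_setPair hE]
      exact hread _ _ fun j h1 h2 => setPair_agree a t 0 _ j h1 h2
    by_cases hy : y g (GapFibre.ow i L (setPair a 0 x) z) = true
    · have heq : (∑ t ∈ range 3, if (y g (GapFibre.ow i L (setPair a t x) z) = true ∧
            (c + g.val + walkExp (GapFibre.ow i L (setPair a t x) z) g.val) % 3 ≠ 0) then 1 else 0) =
          ∑ t ∈ range 3, if (c + g.val + walkExp (GapFibre.ow i L (setPair a t x) z) g.val) % 3 ≠ 0 then 1 else 0 :=
        Finset.sum_congr rfl fun t _ => by simp only [hfire t, hy, true_and]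
      rw [heq]
      rcases hga with hl | hr
      · rw [PairLocal.sum3_indicator (fun t => c + g.val + walkExp (GapFibre.ow i L (setPair a t x) z) g.val)
          (c + g.val + wt (setPair a 0 (GapFibre.ow i L x z)) + wtPrefix (setPair a 0 (GapFibre.ow i L x z)) g.val)
          1 (Or.inl rfl) (fun t ht => by
            show (c + g.val + walkExp (GapFibre.ow i L (setPair a t x) z) g.val) % 3 = _
            unfold walkExp
            rw [ow_setPair hE, wt_setPair ha ht, wtPrefix_setPair_of_le a t _ hl]
            omega)]
      · rw [PairLocal.sum3_indicator (fun t => c + g.val + walkExp (GapFibre.ow i L (setPair a t x) z) g.val)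
          (c + g.val + wt (setPair a 0 (GapFibre.ow i L x z)) + wtPrefix (setPair a 0 (GapFibre.ow i L x z)) g.val)
          2 (Or.inr rfl) (fun t ht => by
            show (c + g.val + walkExp (GapFibre.ow i L (setPair a t x) z) g.val) % 3 = _
            unfold walkExp
            rw [ow_setPair hE, wt_setPair ha ht, wtPrefix_setPair_of_ge ha ht _ hr]
            omega)]
    · have heq : (∑ t ∈ range 3, if (y g (GapFibre.ow i L (setPair a t x) z) = true ∧
            (c + g.val + walkExp (GapFibre.ow i L (setPair a t x) z) g.val) % 3 ≠ 0) then 1 else 0) = 0 :=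
        Finset.sum_eq_zero fun t _ => by rw [if_neg]; rw [hfire t]; exact fun h => hy h.1
      rw [heq]
      exact dvd_zero 2
  have h1 : (∑ t ∈ range 3, winCount c y (GapFibre.ow i L (setPair a t x) z)) =
      (∑ t ∈ range 3, ∑ g ∈ univ.filter (fun g : Fin (n + 1) => g ∈ T),
        (if (y g (GapFibre.ow i L (setPair a t x) z) = true ∧
          (c + g.val + walkExp (GapFibre.ow i L (setPair a t x) z) g.val) % 3 ≠ 0) then 1 else 0)) +
      ∑ t ∈ range 3, ∑ g ∈ univ.filter (fun g : Fin (n + 1) => ¬ g ∈ T),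
        (if (y g (GapFibre.ow i L (setPair a t x) z) = true ∧
          (c + g.val + walkExp (GapFibre.ow i L (setPair a t x) z) g.val) % 3 ≠ 0) then 1 else 0) := by
    rw [← Finset.sum_add_distrib]
    exact Finset.sum_congr rfl fun t _ => hsplit t
  have h2 : (∑ t ∈ range 3, ∑ g ∈ univ.filter (fun g : Fin (n + 1) => g ∈ T),
      (if (y g (GapFibre.ow i L (setPair a t x) z) = true ∧
        (c + g.val + walkExp (GapFibre.ow i L (setPair a t x) z) g.val) % 3 ≠ 0) then 1 else 0)) =
      Q y T i L a c x z (wt z % 3) := by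
    unfold Q
    exact Finset.sum_congr rfl hspec
  rw [h1, h2]
  omega

/-- **One of the three representatives loses** whenever `Q_{|z| mod 3}(x,z)` is even. -/
theorem exists_speed_loses {i L a : ℕ} (hiL : i + L ≤ n) (hE : i + L ≤ a ∨ a + 2 ≤ i) (ha : a + 1 < n) (c : ℕ)
    (y : Fin (n + 1) → (Fin n → Bool) → Bool) (T : Finset (Fin (n + 1)))
    (hT : ∀ g ∈ T, g.val ≤ i ∨ i + L ≤ g.val)
    (hns : ∀ g : Fin (n + 1), g ∉ T → (g.val ≤ a ∨ a + 2 ≤ g.val) ∧ ∀ u u' : Fin n → Bool,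
      (∀ j : Fin n, j.val ≠ a → j.val ≠ a + 1 → u j = u' j) → y g u = y g u')
    (x : Fin n → Bool) (z : Fin L → Bool) (hQ : Q y T i L a c x z (wt z % 3) % 2 = 0) :
    ∃ t, t < 3 ∧ ringWinU c y (GapFibre.ow i L (setPair a t x) z) = false := by
  by_contra hall
  push Not at hall
  have hwin : ∀ t, t < 3 → winCount c y (GapFibre.ow i L (setPair a t x) z) % 2 = 1 := by
    intro t ht
    have h := hall t ht
    rw [ringWinU_eq_decide] at h
    by_contra hne
    exact h (decide_eq_false hne)
  have hsum := sum_winCount_mod_two hiL hE ha c y T hT hns x z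
  rw [hQ, Finset.sum_range_succ, Finset.sum_range_succ, Finset.sum_range_succ, Finset.sum_range_zero] at hsum
  have h0 := hwin 0 (by norm_num)
  have h1 := hwin 1 (by norm_num)
  have h2 := hwin 2 (by norm_num)
  omega

/-! ### The losing residue -/

/-- `Q_0 + Q_1 + Q_2` is even: a fired special cut on a given speed is charged against exactly two residues
(`speed ∈ {1, 2}` is invertible mod 3). -/
theorem sum_Q_mod_two (y : Fin (n + 1) → (Fin n → Bool) → Bool) (T : Finset (Fin (n + 1))) (i L a c : ℕ)
    (x : Fin n → Bool) (z : Fin L → Bool) :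
    (Q y T i L a c x z 0 + Q y T i L a c x z 1 + Q y T i L a c x z 2) % 2 = 0 := by
  have hQ : ∀ ω, Q y T i L a c x z ω = ∑ t ∈ range 3, ∑ g ∈ T,
      (if (y g (GapFibre.ow i L (setPair a t x) z) = true ∧
        (GapFibre.kappa i L c (setPair a t x) g.val + GapFibre.speed i g.val * ω) % 3 ≠ 0) then 1 else 0) :=
    fun ω => by
      unfold Q
      exact Finset.sum_congr rfl fun t _ => Finset.card_filter _ _
  have h3 : Q y T i L a c x z 0 + Q y T i L a c x z 1 + Q y T i L a c x z 2 =
      ∑ ω ∈ range 3, Q y T i L a c x z ω := by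
    rw [Finset.sum_range_succ, Finset.sum_range_succ, Finset.sum_range_succ, Finset.sum_range_zero, zero_add]
  rw [h3]
  refine Nat.mod_eq_zero_of_dvd ?_
  simp_rw [hQ]
  rw [Finset.sum_comm]
  refine Finset.dvd_sum fun t _ => ?_
  rw [Finset.sum_comm]
  refine Finset.dvd_sum fun g _ => ?_
  by_cases hy : y g (GapFibre.ow i L (setPair a t x) z) = true
  · have heq : (∑ ω ∈ range 3, if (y g (GapFibre.ow i L (setPair a t x) z) = true ∧
          (GapFibre.kappa i L c (setPair a t x) g.val + GapFibre.speed i g.val * ω) % 3 ≠ 0) then 1 else 0) =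
        ∑ ω ∈ range 3, if (GapFibre.kappa i L c (setPair a t x) g.val + GapFibre.speed i g.val * ω) % 3 ≠ 0
          then 1 else 0 :=
      Finset.sum_congr rfl fun ω _ => by simp only [hy, true_and]
    rw [heq]
    by_cases hgi : g.val ≤ i
    · rw [PairLocal.sum3_indicator (fun ω => GapFibre.kappa i L c (setPair a t x) g.val + GapFibre.speed i g.val * ω)
        (GapFibre.kappa i L c (setPair a t x) g.val) 1 (Or.inl rfl) (fun ω _ => by
          show (GapFibre.kappa i L c (setPair a t x) g.val + GapFibre.speed i g.val * ω) % 3 = _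
          unfold GapFibre.speed; rw [if_pos hgi])]
    · rw [PairLocal.sum3_indicator (fun ω => GapFibre.kappa i L c (setPair a t x) g.val + GapFibre.speed i g.val * ω)
        (GapFibre.kappa i L c (setPair a t x) g.val) 2 (Or.inr rfl) (fun ω _ => by
          show (GapFibre.kappa i L c (setPair a t x) g.val + GapFibre.speed i g.val * ω) % 3 = _
          unfold GapFibre.speed; rw [if_neg hgi])]
  · rw [Finset.sum_eq_zero fun ω _ => by rw [if_neg]; exact fun h => hy h.1]
    exact dvd_zero 2

/-- The losing residue `ω♭(x,z)`: the least `ω ∈ {0,1,2}` with `Q_ω(x,z)` even. -/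
def omegaBad (y : Fin (n + 1) → (Fin n → Bool) → Bool) (T : Finset (Fin (n + 1))) (i L a c : ℕ)
    (x : Fin n → Bool) (z : Fin L → Bool) : ℕ :=
  if Q y T i L a c x z 0 % 2 = 0 then 0 else if Q y T i L a c x z 1 % 2 = 0 then 1 else 2

/-- `ω♭ < 3`. -/
theorem omegaBad_lt (y : Fin (n + 1) → (Fin n → Bool) → Bool) (T : Finset (Fin (n + 1))) (i L a c : ℕ)
    (x : Fin n → Bool) (z : Fin L → Bool) : omegaBad y T i L a c x z < 3 := by
  unfold omegaBad; split_ifs <;> norm_num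

/-- `Q_{ω♭}` is even. -/
theorem Q_omegaBad_mod_two (y : Fin (n + 1) → (Fin n → Bool) → Bool) (T : Finset (Fin (n + 1))) (i L a c : ℕ)
    (x : Fin n → Bool) (z : Fin L → Bool) : Q y T i L a c x z (omegaBad y T i L a c x z) % 2 = 0 := by
  have h := sum_Q_mod_two y T i L a c x z
  unfold omegaBad
  split_ifs with h0 h1
  · exact h0
  · exact h1
  · omega

/-- `Q_ω(x,z)` reads `z` only through the special firing bits. -/
theorem Q_congr {y : Fin (n + 1) → (Fin n → Bool) → Bool} {T : Finset (Fin (n + 1))} {i L a c : ℕ}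
    {x : Fin n → Bool} {z z' : Fin L → Bool}
    (h : ∀ t, t < 3 → ∀ g ∈ T, y g (GapFibre.ow i L (setPair a t x) z) = y g (GapFibre.ow i L (setPair a t x) z'))
    (ω : ℕ) : Q y T i L a c x z ω = Q y T i L a c x z' ω := by
  unfold Q
  refine Finset.sum_congr rfl fun t ht => ?_
  congr 1
  exact Finset.filter_congr fun g hg => by rw [h t (mem_range.1 ht) g hg]

/-- `ω♭(x,z)` reads `z` only through the special firing bits. -/
theorem omegaBad_congr {y : Fin (n + 1) → (Fin n → Bool) → Bool} {T : Finset (Fin (n + 1))} {i L a c : ℕ}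
    {x : Fin n → Bool} {z z' : Fin L → Bool}
    (h : ∀ t, t < 3 → ∀ g ∈ T, y g (GapFibre.ow i L (setPair a t x) z) = y g (GapFibre.ow i L (setPair a t x) z')) :
    omegaBad y T i L a c x z = omegaBad y T i L a c x z' := by
  unfold omegaBad
  rw [Q_congr h 0, Q_congr h 1]

/-- **A losing representative exists** as soon as the block weight names the losing residue: `ω♭(x,z) = |z| mod 3`. -/
theorem exists_loss_of_omegaBad_eq {i L a : ℕ} (hiL : i + L ≤ n) (hE : i + L ≤ a ∨ a + 2 ≤ i) (ha : a + 1 < n)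
    (c : ℕ) (y : Fin (n + 1) → (Fin n → Bool) → Bool) (T : Finset (Fin (n + 1)))
    (hT : ∀ g ∈ T, g.val ≤ i ∨ i + L ≤ g.val)
    (hns : ∀ g : Fin (n + 1), g ∉ T → (g.val ≤ a ∨ a + 2 ≤ g.val) ∧ ∀ u u' : Fin n → Bool,
      (∀ j : Fin n, j.val ≠ a → j.val ≠ a + 1 → u j = u' j) → y g u = y g u')
    (x : Fin n → Bool) (z : Fin L → Bool) (hω : omegaBad y T i L a c x z = wt z % 3) :
    ∃ t, t < 3 ∧ ringWinU c y (GapFibre.ow i L (setPair a t x) z) = false :=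
  exists_speed_loses hiL hE ha c y T hT hns x z (by rw [← hω]; exact Q_omegaBad_mod_two y T i L a c x z)

/-! ### Degrees -/

section Degree

variable {p : ℕ} [Fact p.Prime]

/-- **Level sets of `ω♭` have low degree**: the indicator of `{z : ω♭(x,z) ≡ r (mod 3)}` has `𝔽_p`-degree `≤ 3|T|·D` when
every cut has degree `≤ D`. -/
theorem levelSet_mem_lowDeg (y : Fin (n + 1) → (Fin n → Bool) → Bool) {D : ℕ} (hy : ∀ g, HasDegF p (y g) D)
    (T : Finset (Fin (n + 1))) (i L a c : ℕ) (x : Fin n → Bool) (r : ℕ) :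
    (fun z : Fin L → Bool => if omegaBad y T i L a c x z % 3 = r % 3 then (1 : ZMod p) else 0) ∈
      lowDeg (ZMod p) L (3 * T.card * D) := by
  classical
  let h : ℕ × Fin (n + 1) → (Fin L → Bool) → Bool := fun tg z => y tg.2 (GapFibre.ow i L (setPair a tg.1 x) z)
  let A : Finset (ℕ × Fin (n + 1)) := (range 3) ×ˢ T
  have hA : A.card = 3 * T.card := by
    simp only [A, Finset.card_product, Finset.card_range]
  have hh : ∀ tg ∈ A, (fun z => if h tg z = true then (1 : ZMod p) else 0) ∈ lowDeg (ZMod p) L D :=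
    fun tg _ => GapFibre.ind_comp_ow_mem_lowDeg (setPair a tg.1 x) (hy tg.2)
  have hf : ∀ z z' : Fin L → Bool, (∀ tg ∈ A, h tg z = h tg z') →
      decide (omegaBad y T i L a c x z % 3 = r % 3) = decide (omegaBad y T i L a c x z' % 3 = r % 3) := by
    intro z z' hzz
    rw [omegaBad_congr (fun t ht g hg => hzz (t, g) (mem_product.2 ⟨mem_range.2 ht, hg⟩))]
  have key := GapFibre.ind_mem_lowDeg_of_pattern (F := ZMod p) A h hh
    (fun z => decide (omegaBad y T i L a c x z % 3 = r % 3)) hf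
  rw [hA] at key
  have heq : (fun z : Fin L → Bool => if omegaBad y T i L a c x z % 3 = r % 3 then (1 : ZMod p) else 0) =
      fun z => if decide (omegaBad y T i L a c x z % 3 = r % 3) = true then (1 : ZMod p) else 0 := by
    funext z
    by_cases hz : omegaBad y T i L a c x z % 3 = r % 3
    · rw [if_pos hz, if_pos (decide_eq_true hz)]
    · rw [if_neg hz, if_neg (by rw [decide_eq_false hz]; exact Bool.false_ne_true)]
  rw [heq]
  exact key

end Degree

end FewReaders

end Summit.QuantumAdvantage.AdviceFreeQNC0
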